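import Literature.MathematicalPhysics.QuantumFieldTheory.Balaban1983to89.B9Thm311FlatHolonomyKernelZdPerNested

/-!
# `Balaban1983to89.B9Thm311ClassCompactnessZdPerNested` — [Balaban1985BackgroundPropagators] Thm 3.11 p. 416 ∕ (3.27) p. 395 FOR THE WHOLE SMALL-FIELD CLASS (1.7)
# AT EVERY NESTED PERIODIC MEMBER (print's class (1.31) `towerBondsP`, every truncation `m ≤ k`), PER MEMBER: the junction's binder `RegularInClassAtHPer` ∕
# `InvAtHIPer … aI` — the N05 witness slot's displayed `hinv` at the member — is INHABITED for the GENUINE four-letter periodic record `opsAllZdPer`; there is ONE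
# threshold `aI > 0` (member-, `P`-, `τ`-dependent) such that `G_𝔤^per(U₀) = (Δ_a(U₀))⁻¹` exists at EVERY `P`-periodic unitary background `U₀ ∈ 𝔄_m({Ω_j}, α₀)`,
# `α₀ ≤ aI` — dag-n06-b g24's openness + compactness road (`B9Thm311OpenAtFlatHolonomyZdPer` ∕ `B9Thm311ClassCompactnessZdPer`, torus member) with the member
# generalised through `B9Thm311FlatHolonomyKernelZdPerNested`

statement-level skeleton of published theorems with citation tags; proofs where landed; nothing here is a claim about the Yang–Mills mass gap

`[Balaban1985BackgroundPropagators]` ("B9", CMP **99** (1985) 389–434) Thm 3.11 p. 416: *«There exist constants M₀, α₀′ such that for M ≥ M₀, Mα₀ ≤ α₀′ and for U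
satisfying (3.35) the operators Δ′_a, G′, Q′G′²Q′*, (Q′G′²Q′*)⁻¹, Δ_a, G are positive definite … uniformly in U, Ω_j»*; (3.26)–(3.27) p. 395.  `[Balaban1985RegularSpaces]`
(1.7) p. 77 *«|U(∂p) − 1| < α₀L^{−2j} for p ∈ Ω_j»* (the class `𝔄_k({Ω_j}, α₀)`), (1.3)–(1.6) p. 77, (1.31) p. 82, (1.58) p. 86, p. 77 *«Ω_j ⊂ T_η»*.  `[Balaban1985Averaging]`
Prop. 2 (52)–(54) p. 26 (the averaged configurations of a class background are unitary).

CITATION HEADER (lean-in-tree rule).  Cell `pub-ymgap` (YM Track A), DAG node N06 = [B9], seat `pub-ymgap-dag-n06-b` (g25), the (β′-PERIODIC) road; own take of HANDOFF §2r (b).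
WHY: the N05 witness slot of record (R467) displays `hinv : ∀ (a : IdxB8SubDPerκ …) (m ≤ k), InvAtHIPer P θ.L (opsAllZdPer τ θ.L P (towerBondsP θ.L a.Ω (a.Λs ·) ·) ops₀) aI
M a.toZdIdx m`; dag-n06-b g24 proved it at the all-torus member `torusIdx` only.  THIS FILE proves it PER MEMBER at every nested periodic member (`∃ aI > 0` for each
`(a, m)`): §1 the level-`0` clause of (1.7) with `Ω₀ = ℤᵈ` bounds EVERY plaquette, so a class background at threshold `α₀ ≤ (α_Q∕L²)·L^{−2m}` lies in the canonical regime set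
of the ALL-`ℤᵈ` tower (`Reg17 L m ℤᵈ (α_Q∕L²)`, averaged transporters unitary EVERYWHERE — the typed periodic letters' regime); §2 g24's
`regularAtHPer_eventually_opsAllZdPer_of_flat` (general member ∕ class) at the member with every hypothesis a theorem of `B9Thm311FlatHolonomyKernelZdPerNested` §3
(level periodicity, a non-empty level, class periodicity ∕ box law, «`Q′` onto», flat positivity); §3 the swallowing lemma on the compact set of periodic unitary backgrounds.

WHAT IS PROVED (kernel, 0 sorry; theorems only — no `def`, no `instance`, no `notation`).
* §1 `norm_plaqF_sub_one_lt_of_inAk_zero` ∕ `norm_plaqF_sub_one_le_of_inAk_zero` ((1.7) level `0` with `Ω₀ = ℤᵈ`), `reg17_univ_of_norm_plaqF_sub_one_lt`, `reg17_of_reg17_univ`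
  ((1.7) monotone in the regions), ★ `mem_canonicalUniv_of_inAk` (class background at `α₀ ≤ (α_Q∕L²)L^{−2m}` ⟹ all-`ℤᵈ` canonical regime: unitary `Ū₀ʲ(Γ)` everywhere, w4's
  `bgT_mem_unitaryUnits_of_reg17UnivP`).
* §2 ★★★ `IdxB8SubDPer.regularAtHPer_eventually_canonicalUniv_of_flat` ((3.27) for the genuine record at `a` for all `U₀` near ANY flat periodic unitary `U₁` within the
  all-`ℤᵈ` canonical regime set; no displayed binder).
* §3 ★★★★ `IdxB8SubDPer.regularInClassAtHPer_opsAllZdPer` (`∃ aI > 0, RegularInClassAtHPer P θ.L (opsLandauPer τ P (withDpZd (withQQP τ θ.L (towerBondsP …) ops₀))) aI M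
  a.toZdIdx m` — THEOREM 3.11 FOR THE WHOLE CLASS (1.7) AT THE MEMBER, `0 < D`, faithful Hermitian tracial `τ`, finite-dimensional fibre), ★★★★
  `IdxB8SubDPer.invAtHIPer_opsAllZdPer` (`∃ aI > 0, InvAtHIPer P θ.L (opsAllZdPer τ θ.L P (towerBondsP …) ops₀) aI M a.toZdIdx m` — THE JUNCTION'S (3.27) BINDER
  INHABITED AT EVERY NESTED PERIODIC MEMBER; the N05 head's `hinv` text at `(a, m)`).

HONEST SCOPE.  (i) QUALITATIVE and PER MEMBER: `aI` exists by compactness and is member- (`η`, `k`, `Ω`), `P`-, `τ`- and record-dependent; the N05 head displays ONE `aI`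
for all members — that uniformity (print's volume-uniform Theorem 3.11, `M₀, α₀′`; the coercivity ∕ random-walk lanes of dag-n06-w3∕w4) is NOT proved here; no estimate of
[B9] (Thm 3.1 ∕ 3.3 ∕ (3.42) NOT proved).  (ii) The other four binders (`GlobAtIPer`, `HolderAtIH2Per`, `SrcAtIPer`, `SrcHolderAtIH2Per`) at nested members are NOT touched
(successor: g24's FILE 3–7 road re-based).  (iii) `0 < D` displayed (used for [B7] Prop. 2's plaquette supremum and for the positivity of an inhabited threshold).  (iv)
Count-neutral; N06 NOT discharged; K1⁹ `stmt-QuantumFields-27364` NOT closed; counts UNMOVED; one finite `𝕋⁴` programme at fixed `ε`, Bałaban as printed; R4 closes only the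
conditional finite-`𝕋⁴` rung `BalabanLadder.UV` — nothing continuum ∕ ℝ⁴ ∕ OS ∕ mass gap ∕ Clay.  Unit `pub-ymgap-dag-n06-b` (g25), 2026-08-28; NEW file importing this seat's
`B9Thm311FlatHolonomyKernelZdPerNested`; modifies nothing.  Net new unproved facts: 0.
-/

noncomputable section

namespace Literature.MathematicalPhysics.QuantumFieldTheory.Balaban1983to89.B9Thm311ClassCompactnessZdPerNested

open Filter Topology
open B7Prop1Explicit B7Eq78Linearization
open B7Prop2Explicit (unitaryUnits mem_unitaryUnits)
open B8Ineq132 (plaqF InAk PlaqTouches)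
open B8Eq119TwistedAxial (bgT)
open B8LeafModelZd (ZdIdx)
open T4TermwiseTorus (IsPeriodic)
open B9SupplySockB9P3ZdLetters (OpsZd deltaAOf)
open B9SupplySockB9P3ZdGammaInAkDpZd (withDpZd)
open B9Eq316AveragingTransposeZd (Reg17 alphaQ alphaQ_pos reg17_of_inAk reg17_mono)
open B9Eq316AveragingTransposeZdPrinted (withQQP)
open B9Eq327GreenZdHermPer (domSubHPer bondPairPer RegularAtHPer RegularInClassAtHPer InvAtHIPer invAtHIPer_withGopZdHPer)
open B9SupplySockB9P3ZdAllLettersZdPer (opsLandauPer opsAllZdPer)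
open B9Thm311OpenAtFlatHolonomyZdPer (regularAtHPer_eventually_opsAllZdPer_of_flat reg17_of_flat bgT_mem_unitaryUnits_of_flat)
open B9Thm311ClassCompactnessZdPer (exists_plaq_threshold_of_open_superset_flat)
open B8TowerBondsPrinted (towerBondsP)
open Node00 (Stage3Params IdxB8SubD IdxB8SubDPer)

-- `Site` alone could resolve to the torus sites of `Setup.lean`; re-export the `ℤ^d` sites of `B7Prop1Explicit`.
export B7Prop1Explicit (Site)

variable {d : ℕ} {𝔸 : Type*} [CStarAlgebra 𝔸]

/-! ## §1  The level-`0` clause of (1.7) controls every plaquette; the canonical regime set of the all-`ℤᵈ` tower at a smaller threshold -/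

section Regime

/-- **THE LEVEL-`0` CLAUSE OF (1.7) WHEN `Ω₀ = ℤᵈ`**: a background of `𝔄_m({Ω_j}, α₀)` with `Ω₀ = ℤᵈ` has EVERY plaquette variable STRICTLY `α₀`-close to `1` off the
diagonal. [cite: Balaban1985RegularSpaces, (1.7) p.77, p.77 («Ω_j ⊂ T_η», Ω₀ the whole torus)] -/
theorem norm_plaqF_sub_one_lt_of_inAk_zero {L m : ℕ} {η α₀ : ℝ} {Ω : ℕ → Set (Site d)} (hΩ : Ω 0 = Set.univ) {U₀ : Site d → Fin d → 𝔸ˣ}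
    (hIn : InAk L m η α₀ Ω U₀) {κ ν : Fin d} (hκν : κ ≠ ν) (x : Site d) : ‖plaqF U₀ κ ν x - 1‖ < α₀ := by
  have h := (hIn 0 (Nat.zero_le m)).1 x κ ν hκν (Or.inl (by rw [hΩ]; exact Set.mem_univ x))
  simpa only [pow_zero, inv_one, one_pow, mul_one] using h

/-- … hence `α₀`-close (diagonal included: the empty plaquette). [cite: Balaban1985RegularSpaces, (1.7) p.77] -/
theorem norm_plaqF_sub_one_le_of_inAk_zero {L m : ℕ} {η α₀ : ℝ} (hα₀ : 0 ≤ α₀) {Ω : ℕ → Set (Site d)} (hΩ : Ω 0 = Set.univ)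
    {U₀ : Site d → Fin d → 𝔸ˣ} (hIn : InAk L m η α₀ Ω U₀) (κ ν : Fin d) (x : Site d) : ‖plaqF U₀ κ ν x - 1‖ ≤ α₀ := by
  by_cases hκν : κ = ν
  · subst hκν
    unfold plaqF
    rw [B7Prop2Explicit.hol_plaqWord_self, Units.val_one, sub_self, norm_zero]
    exact hα₀
  · exact (norm_plaqF_sub_one_lt_of_inAk_zero hΩ hIn hκν x).le

/-- **A UNIFORM PLAQUETTE BOUND `< α·L^{−2m}` IS THE ALL-`ℤᵈ` CLASS (1.7) AT TRUNCATION `m`** (`Reg17 L m ℤᵈ α`: the level-`j` clause asks `< α·L^{−2j} ≥ α·L^{−2m}`, `L ≥ 1`).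
[cite: Balaban1985RegularSpaces, (1.7) p.77, p.77 («we admit … Ω_j = T_η»)] -/
theorem reg17_univ_of_norm_plaqF_sub_one_lt {L : ℕ} (hL : 1 ≤ L) (m : ℕ) {α β : ℝ} (hα : 0 ≤ α) (hβ : β ≤ α * (((L : ℝ) ^ m)⁻¹) ^ 2)
    {U₀ : Site d → Fin d → 𝔸ˣ} (h : ∀ (x : Site d) (μ ν : Fin d), μ ≠ ν → ‖plaqF U₀ μ ν x - 1‖ < β) :
    Reg17 L m (fun _ => (Set.univ : Set (Site d))) α U₀ := by
  intro j hj x μ ν hμν _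
  refine lt_of_lt_of_le (h x μ ν hμν) (hβ.trans ?_)
  have hL1 : (1 : ℝ) ≤ L := by exact_mod_cast hL
  have hmono : ((L : ℝ) ^ m)⁻¹ ≤ ((L : ℝ) ^ j)⁻¹ := inv_anti₀ (pow_pos (by linarith) j) (pow_le_pow_right₀ hL1 hj)
  have hnn : 0 ≤ ((L : ℝ) ^ m)⁻¹ := inv_nonneg.2 (pow_nonneg (by linarith) m)
  exact mul_le_mul_of_nonneg_left (pow_le_pow_left₀ hnn hmono 2) hα

/-- **(1.7) IS MONOTONE IN THE REGIONS**: the all-`ℤᵈ` class implies the class of any region sequence. [cite: Balaban1985RegularSpaces, (1.7) p.77 (bookkeeping)] -/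
theorem reg17_of_reg17_univ {L m : ℕ} (Ω : ℕ → Set (Site d)) {α : ℝ} {U₀ : Site d → Fin d → 𝔸ˣ} (h : Reg17 L m (fun _ => (Set.univ : Set (Site d))) α U₀) :
    Reg17 L m Ω α U₀ :=
  fun j hj x μ ν hμν _ => h j hj x μ ν hμν (Or.inl (Set.mem_univ x))

variable [Nontrivial 𝔸]

/-- **A CLASS BACKGROUND OF A MEMBER WITH `Ω₀ = ℤᵈ` AT A SMALL THRESHOLD LIES IN THE CANONICAL REGIME SET OF THE ALL-`ℤᵈ` TOWER**: for `0 < d`, `2 ≤ L` and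
`α₀ ≤ (α_Q∕L²)·L^{−2m}`, a unitary `P`-periodic `U₀ ∈ 𝔄_m({Ω_j}, α₀)` has `Reg17 L m ℤᵈ (α_Q∕L²)` and unitary averaged transporters `Ū₀ʲ(Γ)`, `j ≤ m`, EVERYWHERE
([Balaban1985Averaging] Prop. 2, dag-n06-w4's `bgT_mem_unitaryUnits_of_reg17UnivP`) — so that every typed periodic letter is in its regime at `U₀`, not only on the
member's `Ω_j`. [cite: Balaban1985RegularSpaces, (1.7) p.77, (1.29) p.81; Balaban1985Averaging, Prop. 2 (52)–(54) p.26] -/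
theorem mem_canonicalUniv_of_inAk (hd : 0 < d) {L : ℕ} (hL2 : 2 ≤ L) (m : ℕ) {P : ℕ} {η α₀ : ℝ} {Ω : ℕ → Set (Site d)} (hΩ : Ω 0 = Set.univ)
    (hα₀ : α₀ ≤ alphaQ d L / (L : ℝ) ^ 2 * (((L : ℝ) ^ m)⁻¹) ^ 2)
    {U₀ : Site d → Fin d → 𝔸ˣ} (hU₀ : ∀ (x : Site d) (κ : Fin d), U₀ x κ ∈ unitaryUnits 𝔸) (hper : IsPeriodic P U₀) (hIn : InAk L m η α₀ Ω U₀) :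
    U₀ ∈ {U₀ : Site d → Fin d → 𝔸ˣ | (∀ (x : Site d) (κ : Fin d), U₀ x κ ∈ unitaryUnits 𝔸) ∧ IsPeriodic P U₀ ∧
        Reg17 L m (fun _ => (Set.univ : Set (Site d))) (alphaQ d L / (L : ℝ) ^ 2) U₀ ∧ ∀ j, j ≤ m → ∀ (x y : Site d), bgT L U₀ j x y ∈ unitaryUnits 𝔸} := by
  have hL1 : 1 ≤ L := le_trans (by norm_num) hL2
  have hL0 : (0 : ℝ) < L := by exact_mod_cast (lt_of_lt_of_le (by norm_num) hL2)
  have hreg : Reg17 L m (fun _ => (Set.univ : Set (Site d))) (alphaQ d L / (L : ℝ) ^ 2) U₀ :=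
    reg17_univ_of_norm_plaqF_sub_one_lt hL1 m (div_pos (alphaQ_pos d hL1) (pow_pos hL0 2)).le hα₀
      fun x μ ν hμν => norm_plaqF_sub_one_lt_of_inAk_zero hΩ hIn hμν x
  exact ⟨hU₀, hper, hreg, B9Thm311PosDefNearFlatZd.bgT_mem_unitaryUnits_of_reg17UnivP hd hL2 m hU₀ hreg⟩

end Regime

/-! ## §2  At a periodic member of record: (3.27) near every flat background within the all-`ℤᵈ` canonical regime set — no displayed binder -/

section Members

open B9Eq325QGGQInvZdPer (QprimeStarPerInjective)
open B9Thm311FlatHolonomyKernelZdPerNested (IdxB8SubDPer.isPeriodic_towerBondsP_Λs IdxB8SubDPer.towerBondsP_box IdxB8SubDPer.exists_periodic_label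
  IdxB8SubDPer.qprimeStarPerInjective IdxB8SubDPer.bondPairPer_deltaAOf_opsAllZdPer_pos_of_flat)

variable {θ : Stage3Params} [FiniteDimensional ℝ θ.𝔸] (τ : θ.𝔸 →ₗ[ℂ] ℂ) (hτp : ∀ x : θ.𝔸, x ≠ 0 → 0 < (τ (star x * x)).re)
  (hτt : ∀ x y : θ.𝔸, τ (x * y) = τ (y * x)) (hτs : ∀ x : θ.𝔸, τ (star x) = starRingEnd ℂ (τ x)) {P : ℕ} [NeZero P]

include hτp hτt hτs in
/-- ★★★ **(3.27) NEAR EVERY FLAT PERIODIC BACKGROUND AT EVERY NESTED PERIODIC MEMBER, WITHIN THE ALL-`ℤᵈ` CANONICAL REGIME SET** (print's class `towerBondsP`,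
truncation `m ≤ k`): for every flat unitary `P`-periodic `U₁` (any holonomy), `RegularAtHPer` for the genuine record at `a : IdxB8SubDPer θ P` holds for all `U₀` NEAR `U₁`
within `{U₀ unitary, P-periodic, Reg17 L m ℤᵈ (α_Q∕L²), Ū₀ʲ(Γ) unitary for j ≤ m}` — dag-n06-b g24's `regularAtHPer_eventually_opsAllZdPer_of_flat` (general member,
general class) with EVERY member-specific hypothesis a THEOREM: level periodicity of `Λs` (dag-n05-w2), a non-empty level and the class's periodicity ∕ box law
(`B9Thm311FlatHolonomyKernelZdPerNested` §3), «`Q′` onto» (`IdxB8SubDPer.qprimeStarPerInjective`), and the flat positivity of `Δ_a(U₁)`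
(`IdxB8SubDPer.bondPairPer_deltaAOf_opsAllZdPer_pos_of_flat` — the nested flat-holonomy kernel).
[cite: Balaban1985BackgroundPropagators, Thm 3.11 p.416, (3.26)–(3.27) p.395; Balaban1985RegularSpaces, (1.7) p.77, (1.58) p.86, (1.3)–(1.6) p.77, (1.31) p.82] -/
theorem IdxB8SubDPer.regularAtHPer_eventually_canonicalUniv_of_flat (a : IdxB8SubDPer θ P) {m : ℕ} (hm : m ≤ a.toZdIdx.k)
    (ops₀ : ℝ → ZdIdx θ.D θ.L → ℕ → OpsZd θ.D θ.𝔸) (M : ℝ) {U₁ : Site θ.D → Fin θ.D → θ.𝔸ˣ}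
    (hU₁ : ∀ x κ, U₁ x κ ∈ unitaryUnits θ.𝔸) (hU₁per : IsPeriodic P U₁) (hflat : ∀ (κ ν : Fin θ.D) (x : Site θ.D), plaqF U₁ κ ν x = 1) :
    ∀ᶠ U₀ in 𝓝[{U₀ : Site θ.D → Fin θ.D → θ.𝔸ˣ | (∀ (x : Site θ.D) (κ : Fin θ.D), U₀ x κ ∈ unitaryUnits θ.𝔸) ∧ IsPeriodic P U₀ ∧
        Reg17 θ.L m (fun _ => (Set.univ : Set (Site θ.D))) (alphaQ θ.D θ.L / (θ.L : ℝ) ^ 2) U₀ ∧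
        ∀ j, j ≤ m → ∀ (x y : Site θ.D), bgT θ.L U₀ j x y ∈ unitaryUnits θ.𝔸}] U₁,
      RegularAtHPer a.toZdIdx.η
        (opsLandauPer τ P (withDpZd (withQQP τ θ.L (fun k j => towerBondsP θ.L a.toZdIdx.Ω (a.toZdIdx.Λs k) j) ops₀)) M a.toZdIdx m) P U₀ := by
  haveI : NeZero θ.L := ⟨by have := θ.two_le_L; omega⟩
  have hL1 : 1 ≤ θ.L := le_trans (by norm_num) θ.two_le_L
  have hL0 : (0 : ℝ) < θ.L := by exact_mod_cast (lt_of_lt_of_le (by norm_num) θ.two_le_L)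
  obtain ⟨j₀, hj₀, y₀, hy₀, -⟩ := IdxB8SubDPer.exists_periodic_label a hm
  refine regularAtHPer_eventually_opsAllZdPer_of_flat τ hτp hτt hτs θ.two_le_L (fun k j => towerBondsP θ.L a.toZdIdx.Ω (a.toZdIdx.Λs k) j) ops₀ M
    a.toZdIdx m (a.dvd_level hm) (fun j hj => a.isPeriodic_Λs hm hj) hj₀ ⟨y₀, hy₀⟩ (fun j hj κ => IdxB8SubDPer.isPeriodic_towerBondsP_Λs a hm hj κ)
    (fun j _ hj => IdxB8SubDPer.towerBondsP_box a m j hj) ⟨hU₁, hU₁per, ?_, ?_⟩ hU₁ hU₁per hflat (fun U₀ hU₀ => hU₀.1) (fun U₀ hU₀ => hU₀.2.1)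
    (fun U₀ hU₀ => reg17_of_reg17_univ a.toZdIdx.Ω hU₀.2.2.1) (fun U₀ hU₀ => hU₀.2.2.2) (fun U₀ _ => IdxB8SubDPer.qprimeStarPerInjective a hm U₀)
    (fun A hA hA0 => IdxB8SubDPer.bondPairPer_deltaAOf_opsAllZdPer_pos_of_flat τ hτt hτs hτp a hm ops₀ M hU₁ hU₁per hflat hA hA0)
  · exact reg17_of_flat hL1 m _ (div_pos (alphaQ_pos θ.D hL1) (pow_pos hL0 2)) hflat
  · exact fun j _ x y => bgT_mem_unitaryUnits_of_flat θ.L hU₁ hflat j x y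

/-! ## §3  Theorem 3.11 for the whole class (1.7) at every nested periodic member; the junction's (3.27) binder `InvAtHIPer` inhabited -/

include hτp hτt hτs in
/-- ★★★★ **THEOREM 3.11 ON THE TORUS FOR THE WHOLE CLASS (1.7) AT EVERY NESTED PERIODIC MEMBER, FOR THE GENUINE RECORD OVER PRINT'S CLASS**: for `0 < D`, a faithful
Hermitian tracial `τ` on the finite-dimensional fibre, `a : IdxB8SubDPer θ P` and `m ≤ k` there is `aI > 0` such that at EVERY `P`-periodic unitary background
`U₀ ∈ 𝔄_m({Ω_j}, α₀)` with `α₀ ≤ aI`, `Δ_a(U₀)` of the genuine four-letter periodic record is invertible on `E_𝔤^per(P)` — `RegularInClassAtHPer`.  Proof = dag-n06-b g24's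
at `torusIdx` with the member generalised: the swallowing lemma applied to the interior of `{U₀ ∈ all-ℤᵈ canonical regime ⟹ RegularAtHPer}`, a neighbourhood of every flat
periodic unitary background by §2; `aI := min α ((α_Q∕L²)·L^{−2m})` (§1).  The threshold is member-dependent (compactness), NOT print's uniform `α₀′`.
[cite: Balaban1985BackgroundPropagators, Thm 3.11 p.416, (3.26)–(3.27) p.395; Balaban1985RegularSpaces, (1.7) p.77, (1.33) p.82, (1.3)–(1.6) p.77, (1.31) p.82, p.77 («Ω_j ⊂ T_η»)] -/
theorem IdxB8SubDPer.regularInClassAtHPer_opsAllZdPer (hD : 0 < θ.D) (a : IdxB8SubDPer θ P) {m : ℕ} (hm : m ≤ a.toZdIdx.k)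
    (ops₀ : ℝ → ZdIdx θ.D θ.L → ℕ → OpsZd θ.D θ.𝔸) (M : ℝ) :
    ∃ aI : ℝ, 0 < aI ∧ RegularInClassAtHPer P θ.L
      (opsLandauPer τ P (withDpZd (withQQP τ θ.L (fun k j => towerBondsP θ.L a.toZdIdx.Ω (a.toZdIdx.Λs k) j) ops₀))) aI M a.toZdIdx m := by
  have hL2 := θ.two_le_L
  have hL1 : 1 ≤ θ.L := le_trans (by norm_num) hL2
  have hL0 : (0 : ℝ) < θ.L := by exact_mod_cast (lt_of_lt_of_le (by norm_num) hL2)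
  set i : ZdIdx θ.D θ.L := a.toZdIdx with hi
  -- the all-`ℤᵈ` canonical regime set and the target property
  set 𝒰 : Set (Site θ.D → Fin θ.D → θ.𝔸ˣ) := {U₀ | (∀ (x : Site θ.D) (κ : Fin θ.D), U₀ x κ ∈ unitaryUnits θ.𝔸) ∧ IsPeriodic P U₀ ∧
      Reg17 θ.L m (fun _ => (Set.univ : Set (Site θ.D))) (alphaQ θ.D θ.L / (θ.L : ℝ) ^ 2) U₀ ∧
      ∀ j, j ≤ m → ∀ (x y : Site θ.D), bgT θ.L U₀ j x y ∈ unitaryUnits θ.𝔸} with h𝒰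
  set R : (Site θ.D → Fin θ.D → θ.𝔸ˣ) → Prop := fun U₀ =>
    RegularAtHPer i.η (opsLandauPer τ P (withDpZd (withQQP τ θ.L (fun k j => towerBondsP θ.L i.Ω (i.Λs k) j) ops₀)) M i m) P U₀ with hR
  set N : Set (Site θ.D → Fin θ.D → θ.𝔸ˣ) := interior {U₀ | U₀ ∈ 𝒰 → R U₀} with hN
  have hNopen : IsOpen N := isOpen_interior
  have hflatN : ∀ U : Site θ.D → Fin θ.D → θ.𝔸ˣ, (∀ (x : Site θ.D) (κ : Fin θ.D), U x κ ∈ unitaryUnits θ.𝔸) → IsPeriodic P U →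
      (∀ (κ ν : Fin θ.D) (x : Site θ.D), plaqF U κ ν x = 1) → U ∈ N := by
    intro U hUu hUp hUf
    have hev := IdxB8SubDPer.regularAtHPer_eventually_canonicalUniv_of_flat τ hτp hτt hτs a hm ops₀ M hUu hUp hUf
    rw [eventually_nhdsWithin_iff] at hev
    exact mem_interior_iff_mem_nhds.2 hev
  obtain ⟨α, hα, hswallow⟩ := exists_plaq_threshold_of_open_superset_flat P hNopen hflatN
  set aQ : ℝ := alphaQ θ.D θ.L / (θ.L : ℝ) ^ 2 * (((θ.L : ℝ) ^ m)⁻¹) ^ 2 with haQ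
  have haQpos : 0 < aQ := mul_pos (div_pos (alphaQ_pos θ.D hL1) (pow_pos hL0 2)) (pow_pos (inv_pos.2 (pow_pos hL0 m)) 2)
  refine ⟨min α aQ, lt_min hα haQpos, ?_⟩
  intro α₀ U₀ hU₀ hper hα₀ hIn
  have hα₀α : α₀ ≤ α := hα₀.trans (min_le_left _ _)
  have hα₀Q : α₀ ≤ aQ := hα₀.trans (min_le_right _ _)
  -- the threshold of an inhabited class is positive: the covariant-divergence clause of (1.7) at level `0` is a strict bound by `α₀ · η⁻¹`
  have hα₀0 : 0 < α₀ := by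
    have h := (hIn 0 (Nat.zero_le m)).2 (0 : Site θ.D) ⟨0, hD⟩ (Or.inl (by rw [show i.Ω 0 = Set.univ from a.Ω_zero]; exact Set.mem_univ _))
    have h' : 0 < α₀ * (((θ.L : ℝ) ^ 0)⁻¹) ^ 2 * ((θ.L : ℝ) ^ 0 * i.η)⁻¹ := (norm_nonneg _).trans_lt h
    simp only [pow_zero, inv_one, one_pow, mul_one, one_mul] at h'
    exact (mul_pos_iff_of_pos_right (inv_pos.2 i.hη)).1 h'
  have hnear : ∀ (x : Site θ.D) (κ ν : Fin θ.D), ‖plaqF U₀ κ ν x - 1‖ ≤ α :=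
    fun x κ ν => (norm_plaqF_sub_one_le_of_inAk_zero hα₀0.le a.Ω_zero hIn κ ν x).trans hα₀α
  have hUN : U₀ ∈ N := hswallow U₀ hU₀ hper hnear
  have hU𝒰 : U₀ ∈ 𝒰 := mem_canonicalUniv_of_inAk hD hL2 m a.Ω_zero hα₀Q hU₀ hper hIn
  exact interior_subset hUN hU𝒰

include hτp hτt hτs in
/-- ★★★★ **THE JUNCTION'S (3.27) BINDER INHABITED AT EVERY NESTED PERIODIC MEMBER FOR THE GENUINE RECORD OVER PRINT'S CLASS** — the N05 witness slot's displayed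
`hinv` AT THE MEMBER `a` AND TRUNCATION `m ≤ k`: `∃ aI > 0, InvAtHIPer P θ.L (opsAllZdPer τ θ.L P (towerBondsP θ.L Ω (Λs ·) ·) ops₀) aI M a.toZdIdx m` — for every
`P`-periodic unitary `U₀ ∈ 𝔄_m({Ω_j}, α₀)`, `α₀ ≤ aI`, every periodic Hermitian `A ∈ E(ℤᵈ)` and every `J` agreeing with `Δ_a(U₀)A` on the bonds, `G_𝔤^per(U₀)J = A`.
dag-n06-b g24's `invAtHIPer_opsAllZdPer_torusIdx` is the all-torus member.  (`0 < D`, faithful Hermitian tracial `τ`, finite-dimensional fibre; `aI` member-dependent.)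
[cite: Balaban1985BackgroundPropagators, (3.27) p.395, Thm 3.11 p.416; Balaban1985RegularSpaces, (1.58) p.86, (1.7) p.77, (1.3)–(1.6) p.77, (1.31) p.82, p.77 («Ω_j ⊂ T_η»)] -/
theorem IdxB8SubDPer.invAtHIPer_opsAllZdPer (hD : 0 < θ.D) (a : IdxB8SubDPer θ P) {m : ℕ} (hm : m ≤ a.toZdIdx.k)
    (ops₀ : ℝ → ZdIdx θ.D θ.L → ℕ → OpsZd θ.D θ.𝔸) (M : ℝ) :
    ∃ aI : ℝ, 0 < aI ∧ InvAtHIPer P θ.L (opsAllZdPer τ θ.L P (fun k j => towerBondsP θ.L a.toZdIdx.Ω (a.toZdIdx.Λs k) j) ops₀) aI M a.toZdIdx m := by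
  obtain ⟨aI, haI, hreg⟩ := IdxB8SubDPer.regularInClassAtHPer_opsAllZdPer τ hτp hτt hτs hD a hm ops₀ M
  exact ⟨aI, haI, invAtHIPer_withGopZdHPer P (opsLandauPer τ P (withDpZd (withQQP τ θ.L (fun k j => towerBondsP θ.L a.toZdIdx.Ω (a.toZdIdx.Λs k) j) ops₀)))
    M a.toZdIdx m a.Ω_zero hreg⟩

end Members

end Literature.MathematicalPhysics.QuantumFieldTheory.Balaban1983to89.B9Thm311ClassCompactnessZdPerNested

end
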